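import Mathlib

/-!
# Two `p`-th-root generators of one degree-`p` purely inseparable extension over a DVR

Topic: `Literature/AlgebraicGeometry/Resolution` (Kummer / Artin–Schreier bookkeeping for
purely inseparable extensions of degree `p` in characteristic `p`). Let `R` be a discrete
valuation ring with uniformizer `ϖ`, fraction field `K` of characteristic `p` and residue map
`x ↦ x̄`, and let `L | K` be a field extension of degree `p`. Suppose `y, y' ∈ L` are two
`p`-th roots of CLEAN radicands, `y^p = u ϖ^n`, `y'^p = u' ϖ^{n'}` (`u, u'` units of `R`),
with `y ∉ K` and `p ∤ n`. Then (`exists_residue_pow_mul_eq_of_pth_roots`) there are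
`0 ≤ j < p`, `m ∈ ℤ` and `c ∈ R`, `d ∈ R ∖ 𝔪` with

  `n' = p m + j n`  and  `d̄^p · ū' = c̄^p · ū^j` in the residue field:

the second radicand has valuation `≡ j · n (mod p)` and, after normalisation, residue equal to
a `p`-th power times `ū^j`. (Consumers: `j ≠ 0` says the two radicands "share their charge";
`j = 0` says `n' ∈ pℤ` and `ū' = (c̄/d̄)^p` is a `p`-th power in the residue field.)

## Proof

* `linearIndependent_pow_of_pow_eq_algebraMap`: `1, y, …, y^{p-1}` are `K`-linearly
  independent (the minimal polynomial of `y` is `T^p - u ϖ^n`, irreducible by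
  `X_pow_sub_C_irreducible_of_prime` since `y ∉ K` and Frobenius is injective on `L`), hence a
  `K`-basis as `[L : K] = p`; so `y' = Σ_{j<p} κ_j y^j` and, by additivity of Frobenius,
  `u' ϖ^{n'} = Σ_j κ_j^p (u ϖ^n)^j` in `K` (`exists_eq_sum_smul_pow_and_pow_eq`).
* `exists_residue_pow_mul_eq_of_pow_mul_eq_sum` (the ring-level statement): clearing
  denominators, `D^p u' ϖ^{n'} = Σ_j N_j^p (u ϖ^n)^j` in `R` with `D ≠ 0`. Writing
  `N_j = ϖ^{e_j} r_j` with `ϖ ∤ r_j`, the `ϖ`-orders `p e_j + j n` of the non-zero terms are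
  pairwise distinct (they are distinct modulo `p` as `p ∤ n`, `0 ≤ j < p`), so the term of least
  order, at `j₀`, dominates: the sum is `≡ ϖ^{μ} r_{j₀}^p u^{j₀}` modulo `ϖ^{μ+1}`,
  `μ = p e_{j₀} + j₀ n`. Comparing with `D = ϖ^δ D₀`, `ϖ ∤ D₀`
  (`eq_and_dvd_sub_of_pow_succ_dvd_sub`): `p δ + n' = μ` and `ϖ ∣ D₀^p u' - r_{j₀}^p u^{j₀}`,
  which is the claim with `j = j₀`, `m = e_{j₀} - δ`, `c = r_{j₀}`, `d = D₀`.

## Sources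

Folklore (the ultrametric "dominant term" computation for `p`-th roots of monomials in
characteristic `p`; cf. the hyperbolic/Kummer coverings in V. Cossart, O. Piltant,
*Resolution of singularities of threefolds in positive characteristic I*, J. Algebra 320
(2008), and F.-V. Kuhlmann's classification of Artin–Schreier defect extensions). No single
printed source is followed; everything here is proved from Mathlib.

## Not here

Nothing about valuations of rank `> 1` or regular local rings of dimension `> 1`, and nothing
in the case `p ∣ n`, where the statement fails: over `R = k[t]_{(t)}`, `ϖ = t`, the elements
`y = (1 + t)^{1/p}` and `y' = y - 1 = t^{1/p}` generate the same extension, with `n = 0`,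
`n' = 1 ∉ pℤ + 0`.
-/

noncomputable section

open IsLocalRing Polynomial

namespace Literature.AlgebraicGeometry.Resolution

/-! ### The `K`-basis `1, y, …, y^{p-1}` and Frobenius -/

section Basis

variable {A K L : Type*} [CommRing A] [Field K] [Algebra A K] [Field L] [Algebra K L]
  [Algebra A L] [IsScalarTower A K L]

/-- If `K` has prime characteristic `p`, `L | K` is a field extension and `y ∈ L ∖ K` satisfies
`y^p = a` with `a` (the image of an element) of `A → K`, then `1, y, …, y^{p-1}` are
`K`-linearly independent: the minimal polynomial of `y` is `T^p - a`, irreducible because `a`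
is not a `p`-th power in `K` (a `p`-th root `b ∈ K` would give `b = y` by injectivity of
Frobenius on `L`). [folklore] -/
theorem linearIndependent_pow_of_pow_eq_algebraMap {p : ℕ} (hp : p.Prime) [CharP K p] (a : A)
    (y : L) (hy : y ∉ Set.range (algebraMap K L)) (hyp : y ^ p = algebraMap A L a) :
    LinearIndependent K fun j : Fin p => y ^ (j : ℕ) := by
  haveI : Fact p.Prime := ⟨hp⟩
  haveI : CharP L p := charP_of_injective_algebraMap (algebraMap K L).injective p
  have hirr : Irreducible ((X : K[X]) ^ p - C (algebraMap A K a)) := by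
    refine X_pow_sub_C_irreducible_of_prime hp fun b hb => hy ⟨b, ?_⟩
    have h1 : (algebraMap K L b) ^ p = y ^ p := by
      rw [← map_pow, hb, hyp, ← IsScalarTower.algebraMap_apply]
    exact frobenius_inj L p h1
  have hroot : aeval y ((X : K[X]) ^ p - C (algebraMap A K a)) = 0 := by
    simp only [map_sub, map_pow, aeval_X, aeval_C, ← IsScalarTower.algebraMap_apply, hyp,
      sub_self]
  have hmin : minpoly K y = (X : K[X]) ^ p - C (algebraMap A K a) :=
    (minpoly.eq_of_irreducible_of_monic hirr hroot (monic_X_pow_sub_C _ hp.ne_zero)).symm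
  have hnat : (minpoly K y).natDegree = p := by
    rw [hmin, natDegree_X_pow_sub_C]
  exact (linearIndependent_pow (K := K) y).comp (Fin.cast hnat.symm) (Fin.cast_injective _)

/-- If moreover `[L : K] = p`, then `1, y, …, y^{p-1}` is a `K`-basis of `L`, and for every
`x ∈ L` there are `κ_0, …, κ_{p-1} ∈ K` with `x = Σ_j κ_j y^j` and — Frobenius being additive in
characteristic `p` — `x^p = Σ_j κ_j^p a^j ∈ K`. [folklore] -/
theorem exists_eq_sum_smul_pow_and_pow_eq {p : ℕ} (hp : p.Prime) [CharP K p]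
    (hdeg : Module.finrank K L = p) (a : A) (y : L) (hy : y ∉ Set.range (algebraMap K L))
    (hyp : y ^ p = algebraMap A L a) (x : L) :
    ∃ κ : Fin p → K, x = ∑ j, κ j • y ^ (j : ℕ) ∧
      x ^ p = algebraMap K L (∑ j, κ j ^ p * algebraMap A K a ^ (j : ℕ)) := by
  haveI : Fact p.Prime := ⟨hp⟩
  haveI : CharP L p := charP_of_injective_algebraMap (algebraMap K L).injective p
  haveI : Nonempty (Fin p) := ⟨⟨0, hp.pos⟩⟩
  have hli : LinearIndependent K fun j : Fin p => y ^ (j : ℕ) :=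
    linearIndependent_pow_of_pow_eq_algebraMap hp a y hy hyp
  have hcard : Fintype.card (Fin p) = Module.finrank K L := by
    rw [Fintype.card_fin, hdeg]
  let b : Module.Basis (Fin p) K L := basisOfLinearIndependentOfCardEqFinrank hli hcard
  have hb : ∀ j, b j = y ^ (j : ℕ) := fun j =>
    congrFun (coe_basisOfLinearIndependentOfCardEqFinrank hli hcard) j
  have hx : x = ∑ j, b.repr x j • y ^ (j : ℕ) := by
    conv_lhs => rw [← b.sum_repr x]
    exact Finset.sum_congr rfl fun j _ => by rw [hb]
  refine ⟨b.repr x, hx, ?_⟩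
  conv_lhs => rw [hx]
  rw [sum_pow_char p, map_sum]
  refine Finset.sum_congr rfl fun j _ => ?_
  rw [_root_.smul_pow, ← pow_mul, mul_comm (j : ℕ) p, pow_mul, hyp]
  simp only [Algebra.smul_def, map_mul, map_pow, ← IsScalarTower.algebraMap_apply]

end Basis

/-! ### Ultrametric bookkeeping with one prime element -/

section Prime

variable {R : Type*} [CommRing R]

/-- A prime `π` not dividing `y` does not divide `y ^ p * v` for a unit `v`. [folklore] -/
theorem not_dvd_pow_mul_of_isUnit {π y v : R} (hπ : Prime π) (hy : ¬ π ∣ y) (hv : IsUnit v)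
    (p : ℕ) : ¬ π ∣ y ^ p * v := by
  intro h
  rcases hπ.dvd_or_dvd h with h | h
  · exact hy (hπ.dvd_of_dvd_pow h)
  · exact hπ.not_unit (isUnit_of_dvd_unit h hv)

/-- **Ultrametric comparison of `π`-orders.** In a domain, if `π` is prime, `π ∤ x`, `π ∤ y`
and `π ^ (m + 1) ∣ π ^ a x - π ^ m y`, then `a = m` and `π ∣ x - y`. [folklore] -/
theorem eq_and_dvd_sub_of_pow_succ_dvd_sub [IsDomain R] {π x y : R} (hπ : Prime π)
    (hx : ¬ π ∣ x) (hy : ¬ π ∣ y) {a m : ℕ} (h : π ^ (m + 1) ∣ π ^ a * x - π ^ m * y) :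
    a = m ∧ π ∣ x - y := by
  have hπ0 : π ≠ 0 := hπ.ne_zero
  rcases lt_trichotomy a m with ham | rfl | hma
  · exfalso
    have h1 : π ^ (a + 1) ∣ π ^ a * x - π ^ m * y :=
      (pow_dvd_pow π (Nat.succ_le_succ ham.le)).trans h
    have h2 : π ^ (a + 1) ∣ π ^ m * y := (pow_dvd_pow π (Nat.succ_le_of_lt ham)).mul_right y
    have h3 : π ^ (a + 1) ∣ π ^ a * x := by simpa using h1.add h2
    rw [pow_succ, mul_dvd_mul_iff_left (pow_ne_zero a hπ0)] at h3
    exact hx h3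
  · refine ⟨rfl, ?_⟩
    rwa [← mul_sub, pow_succ, mul_dvd_mul_iff_left (pow_ne_zero a hπ0)] at h
  · exfalso
    have h1 : π ^ (m + 1) ∣ π ^ a * x := (pow_dvd_pow π (Nat.succ_le_of_lt hma)).mul_right x
    have h3 : π ^ (m + 1) ∣ π ^ m * y := by simpa using h1.sub h
    rw [pow_succ, mul_dvd_mul_iff_left (pow_ne_zero m hπ0)] at h3
    exact hy h3

end Prime

/-! ### The ring-level statement over a DVR -/

section DVR

variable {R : Type*} [CommRing R] [IsDomain R] [IsDiscreteValuationRing R]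

/-- **Dominant term of `Σ_j N_j^p (u ϖ^n)^j` in a DVR.** Let `R` be a discrete valuation ring
with uniformizer `ϖ`, `p` a prime, `u, u'` units, `p ∤ n`, and
`D^p · u' ϖ^{n'} = Σ_{j<p} N_j^p (u ϖ^n)^j` with `D ≠ 0`. Then for some `j < p`, `m ∈ ℤ`,
`c ∈ R` and `d ∈ R ∖ 𝔪`: `n' = p m + j n` and `d̄^p ū' = c̄^p ū^j` in the residue field.
Indeed the `ϖ`-orders `p e_j + j n` (`N_j = ϖ^{e_j} r_j`, `ϖ ∤ r_j`) of the non-zero terms are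
pairwise incongruent modulo `p`, hence pairwise distinct, and the term of least order `j₀`
dominates the sum modulo `ϖ^{order + 1}`; compare with `D = ϖ^δ D₀`, `ϖ ∤ D₀`, to get
`j = j₀`, `m = e_{j₀} - δ`, `c = r_{j₀}`, `d = D₀`. [folklore] -/
theorem exists_residue_pow_mul_eq_of_pow_mul_eq_sum {ϖ : R} (hϖ : Irreducible ϖ) {p : ℕ}
    (hp : p.Prime) (u u' : Rˣ) (n n' : ℕ) (hn : ¬ p ∣ n) {D : R} (hD : D ≠ 0) (N : Fin p → R)
    (h : D ^ p * ((u' : R) * ϖ ^ n') = ∑ j : Fin p, N j ^ p * ((u : R) * ϖ ^ n) ^ (j : ℕ)) :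
    ∃ (j : ℕ) (m : ℤ) (c d : R), j < p ∧ (n' : ℤ) = p * m + j * n ∧ d ∉ maximalIdeal R ∧
      residue R d ^ p * residue R (u' : R) = residue R c ^ p * residue R (u : R) ^ j := by
  classical
  have hπ : Prime ϖ := hϖ.prime
  have hmax : maximalIdeal R = Ideal.span {ϖ} :=
    (IsDiscreteValuationRing.irreducible_iff_uniformizer ϖ).mp hϖ
  -- factoring out powers of `ϖ`
  have fac : ∀ x : R, x ≠ 0 → ∃ (k : ℕ) (z : R), ¬ ϖ ∣ z ∧ x = ϖ ^ k * z := fun x hx =>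
    WfDvdMonoid.max_power_factor' hx hπ.not_unit
  choose! e r hr her using fac
  have hterm : ∀ (z : R) (k j : ℕ), (ϖ ^ k * z) ^ p * ((u : R) * ϖ ^ n) ^ j =
      ϖ ^ (p * k + j * n) * (z ^ p * (u : R) ^ j) := by
    intro z k j
    ring
  -- some numerator is non-zero
  set J : Finset (Fin p) := Finset.univ.filter fun j => N j ≠ 0 with hJ
  have hJne : J.Nonempty := by
    by_contra hJe
    have hN0 : ∀ j, N j = 0 := by
      simpa [hJ, Finset.not_nonempty_iff_eq_empty, Finset.filter_eq_empty_iff] using hJe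
    simp only [hN0, zero_pow hp.ne_zero, zero_mul, Finset.sum_const_zero] at h
    exact mul_ne_zero (pow_ne_zero _ hD) (mul_ne_zero u'.ne_zero (pow_ne_zero _ hπ.ne_zero)) h
  -- the `ϖ`-orders of the non-zero terms are pairwise distinct
  obtain ⟨μ, hμ⟩ : ∃ μ : Fin p → ℕ, ∀ j, μ j = p * e (N j) + (j : ℕ) * n := ⟨_, fun _ => rfl⟩
  have hμ_inj : ∀ j j' : Fin p, μ j = μ j' → j = j' := by
    intro j j' hjj
    have h1 : (j : ℕ) * n ≡ (j' : ℕ) * n [MOD p] := by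
      have h2 := congrArg (· % p) hjj
      simp only [hμ] at h2
      unfold Nat.ModEq
      rwa [add_comm, Nat.add_mul_mod_self_left, add_comm, Nat.add_mul_mod_self_left] at h2
    exact Fin.ext (Nat.ModEq.eq_of_lt_of_lt (Nat.ModEq.cancel_right_of_coprime
      ((Nat.Prime.coprime_iff_not_dvd hp).mpr hn) h1) j.isLt j'.isLt)
  -- the term of least `ϖ`-order dominates
  obtain ⟨j₀, hj₀J, hj₀min⟩ := Finset.exists_min_image J μ hJne
  have hN₀ : N j₀ ≠ 0 := (Finset.mem_filter.mp hj₀J).2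
  have hrest : ϖ ^ (μ j₀ + 1) ∣
      ∑ j ∈ Finset.univ.erase j₀, N j ^ p * ((u : R) * ϖ ^ n) ^ (j : ℕ) := by
    apply Finset.dvd_sum
    intro j hj
    have hjne : j ≠ j₀ := (Finset.mem_erase.mp hj).1
    by_cases hNj : N j = 0
    · simp [hNj, zero_pow hp.ne_zero]
    · have hjJ : j ∈ J := Finset.mem_filter.mpr ⟨Finset.mem_univ _, hNj⟩
      have hlt : μ j₀ < μ j :=
        lt_of_le_of_ne (hj₀min j hjJ) fun heq => hjne (hμ_inj _ _ heq).symm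
      rw [her (N j) hNj, hterm, ← hμ]
      exact (pow_dvd_pow ϖ (Nat.succ_le_of_lt hlt)).mul_right _
  have hsum : (∑ j : Fin p, N j ^ p * ((u : R) * ϖ ^ n) ^ (j : ℕ)) =
      N j₀ ^ p * ((u : R) * ϖ ^ n) ^ (j₀ : ℕ) +
        ∑ j ∈ Finset.univ.erase j₀, N j ^ p * ((u : R) * ϖ ^ n) ^ (j : ℕ) :=
    (Finset.add_sum_erase _ _ (Finset.mem_univ j₀)).symm
  -- compare with the left-hand side
  obtain ⟨δ, D₀, hD₀, rfl⟩ := WfDvdMonoid.max_power_factor' hD hπ.not_unit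
  have hdvd : ϖ ^ (μ j₀ + 1) ∣ ϖ ^ (p * δ + n') * (D₀ ^ p * (u' : R)) -
      ϖ ^ (μ j₀) * (r (N j₀) ^ p * (u : R) ^ (j₀ : ℕ)) := by
    have e1 : ϖ ^ (p * δ + n') * (D₀ ^ p * (u' : R)) =
        (ϖ ^ δ * D₀) ^ p * ((u' : R) * ϖ ^ n') := by ring
    have e2 : ϖ ^ (μ j₀) * (r (N j₀) ^ p * (u : R) ^ (j₀ : ℕ)) =
        N j₀ ^ p * ((u : R) * ϖ ^ n) ^ (j₀ : ℕ) := by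
      rw [hμ, ← hterm, ← her _ hN₀]
    rw [e1, e2, h, hsum, add_sub_cancel_left]
    exact hrest
  obtain ⟨hexp, hdvd₁⟩ := eq_and_dvd_sub_of_pow_succ_dvd_sub hπ
    (not_dvd_pow_mul_of_isUnit hπ hD₀ u'.isUnit p)
    (not_dvd_pow_mul_of_isUnit hπ (hr _ hN₀) (u.isUnit.pow _) p) hdvd
  refine ⟨j₀, (e (N j₀) : ℤ) - δ, r (N j₀), D₀, j₀.isLt, ?_, ?_, ?_⟩
  · rw [hμ] at hexp
    have hcast : (p : ℤ) * δ + n' = p * e (N j₀) + ((j₀ : ℕ) : ℤ) * n := by exact_mod_cast hexp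
    linear_combination hcast
  · rwa [hmax, Ideal.mem_span_singleton]
  · rw [← map_pow, ← map_pow, ← map_pow, ← map_mul, ← map_mul, ← sub_eq_zero, ← map_sub,
      residue_eq_zero_iff, hmax, Ideal.mem_span_singleton]
    exact hdvd₁

end DVR

/-! ### The statement for two `p`-th-root generators -/

/-- **Valuation and residue of a second `p`-th-root generator.** Let `R` be a discrete
valuation ring with uniformizer `ϖ` and fraction field `K` of characteristic `p`, `L | K` of
degree `p`, `u, u' ∈ Rˣ`, and `y, y' ∈ L` with `y ∉ K`, `y^p = u ϖ^n`, `y'^p = u' ϖ^{n'}`,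
`p ∤ n`. Then there are `j < p`, `m ∈ ℤ`, `c ∈ R`, `d ∈ R ∖ 𝔪` with `n' = p m + j n` and
`d̄^p ū' = c̄^p ū^j` in the residue field of `R`: expand `y' = Σ_{j<p} κ_j y^j` on the
`K`-basis of powers of `y`, apply Frobenius to get `u' ϖ^{n'} = Σ κ_j^p (u ϖ^n)^j` in `K`,
clear denominators and read off the dominant term
(`exists_residue_pow_mul_eq_of_pow_mul_eq_sum`). (The hypothesis `y' ∉ K` of the usual
formulation is not needed: for `y' ∈ K` the conclusion holds with `j = 0`.) [folklore] -/
theorem exists_residue_pow_mul_eq_of_pth_roots {R K L : Type*} [CommRing R] [IsDomain R]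
    [IsDiscreteValuationRing R] [Field K] [Algebra R K] [IsFractionRing R K] [Field L]
    [Algebra K L] [Algebra R L] [IsScalarTower R K L] {p : ℕ} (hp : p.Prime) [CharP K p]
    (hdeg : Module.finrank K L = p) {ϖ : R} (hϖ : Irreducible ϖ) (u u' : Rˣ) (n n' : ℕ)
    (hn : ¬ p ∣ n) (y y' : L) (hy : y ∉ Set.range (algebraMap K L))
    (hyp : y ^ p = algebraMap R L (u * ϖ ^ n)) (hyp' : y' ^ p = algebraMap R L (u' * ϖ ^ n')) :
    ∃ (j : ℕ) (m : ℤ) (c d : R), j < p ∧ (n' : ℤ) = p * m + j * n ∧ d ∉ maximalIdeal R ∧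
      residue R d ^ p * residue R (u' : R) = residue R c ^ p * residue R (u : R) ^ j := by
  classical
  -- expansion on the basis of powers of `y` and Frobenius
  obtain ⟨κ, -, hxp⟩ := exists_eq_sum_smul_pow_and_pow_eq hp hdeg _ y hy hyp y'
  have hK : algebraMap R K (u' * ϖ ^ n') =
      ∑ j, κ j ^ p * algebraMap R K (u * ϖ ^ n) ^ (j : ℕ) := by
    apply (algebraMap K L).injective
    rw [← hxp, ← IsScalarTower.algebraMap_apply, ← hyp']
  -- clearing denominators
  obtain ⟨D, hDN⟩ := IsLocalization.exist_integer_multiples_of_finite (nonZeroDivisors R) κ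
  choose N hN using hDN
  have hD : (D : R) ≠ 0 := nonZeroDivisors.coe_ne_zero D
  have key : algebraMap R K ((D : R) ^ p * (u' * ϖ ^ n')) =
      algebraMap R K (∑ j : Fin p, N j ^ p * (u * ϖ ^ n) ^ (j : ℕ)) := by
    rw [map_mul, map_pow, hK, map_sum, Finset.mul_sum]
    refine Finset.sum_congr rfl fun j _ => ?_
    rw [map_mul (algebraMap R K) (N j ^ p), map_pow (algebraMap R K) (N j),
      map_pow (algebraMap R K) _ (j : ℕ), hN j, Algebra.smul_def]
    ring
  exact exists_residue_pow_mul_eq_of_pow_mul_eq_sum hϖ hp u u' n n' hn hD N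
    (IsFractionRing.injective R K key)

end Literature.AlgebraicGeometry.Resolution

end
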